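import Mathlib
import Summits.Ventures.PercRepro2.LocRows
import Summits.Ventures.PercRepro2.SwRow
import Summits.Ventures.PercRepro2.SwOut
import Summits.Ventures.PercRepro2.SwAllRow
import Summits.Ventures.PercRepro2.SwOutAll

/-!
# The series reduction inside an outside class, part 1: vocabulary (blind cell PercRepro2,
night-4 g10, 2026-08-25; proofs/NIGHT4-G10.md §2, Theorem S)

A SERIES VERTEX `u` of the region `U` is a vertex whose only edges are `e₁ = (u, p)` and
`e₂ = (u, q)` (`IsSeriesAt`).  Contracting it (`contractSeries`: `e₂` becomes `(p, q)`, `e₁` a loop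
at the now isolated `u`) or deleting it (`deleteSeries`: both edges become loops at `u`) are graph
operations on the SAME edge type, in the style of `ContractDefs`.  This file: the two operations,
the elementary facts (loops do not change clusters, both edges closed ⟹ the open graphs agree),
the substitution `contractSub` (`e₂ ↦ {e₁, e₂}`) and the TAG `tagSub` (add `e₀` when its end lies in
the cluster whose red edges are given) on edge sets, both monotone.  Parts 2–5: the contraction
half (`SwOutSeriesContract`, `SwOutSeriesContractCount`), the deletion half (`SwOutSeriesDelete`,
`SwOutSeriesDeleteCount`) and Theorem S (`SwOutSeriesThm`).
-/

namespace Summit.Ventures.PercRepro2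

namespace LocRows

open Hull

variable {V : Type*} {E : Type*} [Fintype E] [DecidableEq E]

open scoped Classical

/-- `u` is a SERIES VERTEX with the two edges `e₁ = (u, p)`, `e₂ = (u, q)` and no other edge. -/
structure IsSeriesAt (ends : E → Sym2 V) (u p q : V) (e₁ e₂ : E) : Prop where
  ends₁ : ends e₁ = s(u, p)
  ends₂ : ends e₂ = s(u, q)
  ne : e₁ ≠ e₂
  up : u ≠ p
  uq : u ≠ q
  only : ∀ e, u ∈ ends e → e = e₁ ∨ e = e₂

/-- The contracted graph `G/u`: `e₂` becomes the edge `(p, q)`, `e₁` a loop at the isolated `u`. -/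
noncomputable def contractSeries (ends : E → Sym2 V) (u p q : V) (e₁ e₂ : E) : E → Sym2 V :=
  Function.update (Function.update ends e₂ s(p, q)) e₁ s(u, u)

/-- The deleted graph `G − u`: both edges become loops at the isolated `u`. -/
noncomputable def deleteSeries (ends : E → Sym2 V) (u : V) (e₁ e₂ : E) : E → Sym2 V :=
  Function.update (Function.update ends e₂ s(u, u)) e₁ s(u, u)

variable {ends : E → Sym2 V} {u p q : V} {e₁ e₂ : E}

omit [Fintype E] [DecidableEq E] in
/-- The series structure is symmetric in the two edges. -/
lemma IsSeriesAt.symm (hs : IsSeriesAt ends u p q e₁ e₂) : IsSeriesAt ends u q p e₂ e₁ :=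
  ⟨hs.ends₂, hs.ends₁, hs.ne.symm, hs.uq, hs.up, fun e he => (hs.only e he).symm⟩

omit [Fintype E] in
/-- `deleteSeries` is symmetric in the two edges. -/
lemma deleteSeries_comm (hne : e₁ ≠ e₂) :
    deleteSeries ends u e₁ e₂ = deleteSeries ends u e₂ e₁ := by
  unfold deleteSeries
  exact (Function.update_comm hne.symm _ _ _)

omit [Fintype E] in
/-- `e₁` is a loop at `u` in the contracted graph. -/
lemma contractSeries_apply_e₁ : contractSeries ends u p q e₁ e₂ e₁ = s(u, u) := by
  simp [contractSeries]

omit [Fintype E] in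
/-- `e₂` is the edge `(p, q)` in the contracted graph. -/
lemma contractSeries_apply_e₂ (hne : e₁ ≠ e₂) : contractSeries ends u p q e₁ e₂ e₂ = s(p, q) := by
  simp [contractSeries, Function.update_of_ne hne.symm]

omit [Fintype E] in
/-- The other edges are unchanged by the contraction. -/
lemma contractSeries_apply_of_ne {e : E} (h₁ : e ≠ e₁) (h₂ : e ≠ e₂) :
    contractSeries ends u p q e₁ e₂ e = ends e := by
  simp [contractSeries, Function.update_of_ne h₁, Function.update_of_ne h₂]

omit [Fintype E] in
/-- `e₁` is a loop at `u` in the deleted graph. -/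
lemma deleteSeries_apply_e₁ : deleteSeries ends u e₁ e₂ e₁ = s(u, u) := by
  simp [deleteSeries]

omit [Fintype E] in
/-- `e₂` is a loop at `u` in the deleted graph. -/
lemma deleteSeries_apply_e₂ (hne : e₁ ≠ e₂) : deleteSeries ends u e₁ e₂ e₂ = s(u, u) := by
  simp [deleteSeries, Function.update_of_ne hne.symm]

omit [Fintype E] in
/-- The other edges are unchanged by the deletion. -/
lemma deleteSeries_apply_of_ne {e : E} (h₁ : e ≠ e₁) (h₂ : e ≠ e₂) :
    deleteSeries ends u e₁ e₂ e = ends e := by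
  simp [deleteSeries, Function.update_of_ne h₁, Function.update_of_ne h₂]

omit [Fintype E] [DecidableEq E] in
/-- A vertex `v ≠ u` of an edge `e ∉ {e₁, e₂}` is not `u` (the series vertex has no other edge). -/
lemma ne_u_of_mem_ends (hs : IsSeriesAt ends u p q e₁ e₂) {e : E} (h₁ : e ≠ e₁) (h₂ : e ≠ e₂)
    {v : V} (hv : v ∈ ends e) : v ≠ u := by
  rintro rfl
  rcases hs.only e hv with rfl | rfl
  · exact h₁ rfl
  · exact h₂ rfl

/-! ## Both edges closed: the open graphs agree -/

omit [Fintype E] [DecidableEq E] in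
/-- If `e₁, e₂` are closed in `ω`, the open graph of `ω` is the same for any graph agreeing with
`ends` off `{e₁, e₂}`. -/
lemma openGraph_eq_of_closed {ends' : E → Sym2 V} (hagree : ∀ e, e ≠ e₁ → e ≠ e₂ → ends' e = ends e)
    {ω : Config E} (h₁ : ω e₁ = false) (h₂ : ω e₂ = false) :
    openGraph ends' ω = openGraph ends ω := by
  ext x y
  rw [openGraph_adj, openGraph_adj]
  constructor
  · rintro ⟨hxy, e, he, hends⟩
    have he₁ : e ≠ e₁ := by rintro rfl; simp [h₁] at he
    have he₂ : e ≠ e₂ := by rintro rfl; simp [h₂] at he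
    exact ⟨hxy, e, he, by rw [← hagree e he₁ he₂]; exact hends⟩
  · rintro ⟨hxy, e, he, hends⟩
    have he₁ : e ≠ e₁ := by rintro rfl; simp [h₁] at he
    have he₂ : e ≠ e₂ := by rintro rfl; simp [h₂] at he
    exact ⟨hxy, e, he, by rw [hagree e he₁ he₂]; exact hends⟩

omit [Fintype E] [DecidableEq E] in
/-- Clusters agree when `e₁, e₂` are closed. -/
lemma cluster_eq_of_closed {ends' : E → Sym2 V} (hagree : ∀ e, e ≠ e₁ → e ≠ e₂ → ends' e = ends e)
    {ω : Config E} (h₁ : ω e₁ = false) (h₂ : ω e₂ = false) (x : V) :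
    cluster ends' ω x = cluster ends ω x := by
  ext v
  simp only [mem_cluster, Conn, openGraph_eq_of_closed hagree h₁ h₂]

/-! ## Loops do not matter -/

omit [Fintype E] in
/-- Recolouring a loop does not change the open graph. -/
lemma openGraph_update_of_loop {ends' : E → Sym2 V} {e : E} {w : V} (hloop : ends' e = s(w, w))
    (ω : Config E) (b : Bool) : openGraph ends' (Function.update ω e b) = openGraph ends' ω := by
  ext x y
  rw [openGraph_adj, openGraph_adj]
  constructor
  · rintro ⟨hxy, f, hf, hends⟩
    have hfe : f ≠ e := by
      rintro rfl
      rw [hloop, Sym2.eq_iff] at hends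
      exact hxy (by rcases hends with ⟨h, h'⟩ | ⟨h, h'⟩ <;> first | exact h.symm.trans h' | exact h'.symm.trans h)
    rw [Function.update_of_ne hfe] at hf
    exact ⟨hxy, f, hf, hends⟩
  · rintro ⟨hxy, f, hf, hends⟩
    have hfe : f ≠ e := by
      rintro rfl
      rw [hloop, Sym2.eq_iff] at hends
      exact hxy (by rcases hends with ⟨h, h'⟩ | ⟨h, h'⟩ <;> first | exact h.symm.trans h' | exact h'.symm.trans h)
    exact ⟨hxy, f, by rw [Function.update_of_ne hfe]; exact hf, hends⟩

omit [Fintype E] in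
/-- Recolouring a loop does not change the clusters. -/
lemma cluster_update_of_loop {ends' : E → Sym2 V} {e : E} {w : V} (hloop : ends' e = s(w, w))
    (ω : Config E) (b : Bool) (x : V) :
    cluster ends' (Function.update ω e b) x = cluster ends' ω x := by
  ext v
  simp only [mem_cluster, Conn, openGraph_update_of_loop hloop]

omit [Fintype E] [DecidableEq E] in
/-- Membership in `within`, read off the endpoints. -/
lemma within_iff_of_ends {ends' : E → Sym2 V} {S : Set V} {e : E} {x y : V} (h : ends' e = s(x, y)) :
    e ∈ within ends' S ↔ x ∈ S ∧ y ∈ S := by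
  constructor
  · rintro ⟨a, ha, b, hb, hab⟩
    rw [h, Sym2.eq_iff] at hab
    rcases hab with ⟨rfl, rfl⟩ | ⟨rfl, rfl⟩
    · exact ⟨ha, hb⟩
    · exact ⟨hb, ha⟩
  · rintro ⟨hx, hy⟩
    exact ⟨x, hx, y, hy, h⟩

omit [Fintype E] in
/-- The colour swap commutes with recolouring one edge. -/
lemma blue_update (ζ : Config E) (e : E) (b : Bool) :
    blue (Function.update ζ e b) = Function.update (blue ζ) e (!b) := by
  funext f
  by_cases hf : f = e
  · subst hf; simp [blue]
  · simp [blue, Function.update_of_ne hf]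

variable (e₁ e₂) in
/-- The substitution `e₂ ↦ {e₁, e₂}` on edge sets (the contracted edge stands for both edges of the
series vertex). -/
noncomputable def contractSub (F : Set E) : Set E := if e₂ ∈ F then insert e₁ F else F

omit [Fintype E] [DecidableEq E] in
/-- `contractSub` is monotone. -/
lemma contractSub_mono {F F' : Set E} (h : F ⊆ F') : contractSub e₁ e₂ F ⊆ contractSub e₁ e₂ F' := by
  unfold contractSub
  split_ifs with h₁ h₂
  · exact Set.insert_subset_insert h
  · exact absurd (h h₁) h₂
  · exact h.trans (Set.subset_insert _ _)
  · exact h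

omit [Fintype E] [DecidableEq E] in
/-- Membership in the substituted set. -/
lemma mem_contractSub_iff {F : Set E} {e : E} :
    e ∈ contractSub e₁ e₂ F ↔ e ∈ F ∨ (e = e₁ ∧ e₂ ∈ F) := by
  unfold contractSub
  split_ifs with h
  · simp only [Set.mem_insert_iff, h, and_true]
    tauto
  · simp only [h, and_false, or_false]

omit [Fintype E] [DecidableEq E] in
/-- The preimage of an up-set under `contractSub` is an up-set. -/
lemma isUpperSet_preimage_contractSub {𝓔 : Set (Set E)} (h𝓔 : IsUpperSet 𝓔) :
    IsUpperSet (contractSub e₁ e₂ ⁻¹' 𝓔) :=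
  fun _ _ hFF' hF => h𝓔 (contractSub_mono hFF') hF

/-! ## Tags: the edge sets under deletion -/

variable (ends) in
/-- The TAG: add the edge `e₀` to `F` when its end `p` is `h` or an end of an edge of `F` (i.e. when
`p` lies in the cluster whose red edges are `F`). -/
noncomputable def tagSub (h : V) (e₀ : E) (p : V) (F : Set E) : Set E :=
  if p ∈ insert h {x | ∃ e ∈ F, x ∈ ends e} then insert e₀ F else F

omit [DecidableEq E] in
/-- `tagSub` is monotone. -/
lemma tagSub_mono {h : V} {e₀ : E} {p : V} {F F' : Set E} (hFF : F ⊆ F') :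
    tagSub ends h e₀ p F ⊆ tagSub ends h e₀ p F' := by
  unfold tagSub
  have hmono : p ∈ insert h {x | ∃ e ∈ F, x ∈ ends e} → p ∈ insert h {x | ∃ e ∈ F', x ∈ ends e} := by
    rintro (h' | ⟨e, he, hx⟩)
    · exact Or.inl h'
    · exact Or.inr ⟨e, hFF he, hx⟩
  split_ifs with h₁ h₂
  · exact Set.insert_subset_insert hFF
  · exact absurd (hmono h₁) h₂
  · exact hFF.trans (Set.subset_insert _ _)
  · exact hFF

omit [DecidableEq E] in
/-- The preimage of an up-set under `tagSub` is an up-set. -/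
lemma isUpperSet_preimage_tagSub {h : V} {e₀ : E} {p : V} {𝓔 : Set (Set E)} (h𝓔 : IsUpperSet 𝓔) :
    IsUpperSet (tagSub ends h e₀ p ⁻¹' 𝓔) :=
  fun _ _ hFF' hF => h𝓔 (tagSub_mono hFF') hF

omit [DecidableEq E] in
/-- Membership in the tagged set. -/
lemma mem_tagSub_iff {h : V} {e₀ : E} {p : V} {F : Set E} {e : E} :
    e ∈ tagSub ends h e₀ p F ↔ e ∈ F ∨ (e = e₀ ∧ p ∈ insert h {x | ∃ e ∈ F, x ∈ ends e}) := by
  unfold tagSub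
  split_ifs with h'
  · simp only [Set.mem_insert_iff, h', and_true]
    tauto
  · simp only [h', and_false, or_false]


end LocRows

end Summit.Ventures.PercRepro2
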